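/-
COR-CM (cells pub-hodgecm / pub-hodgecm2, stage 2 of the Hodge ladder) — TRANSPOSITION item (vi), X3-ω: the F-GENERIC KIT behind the pins
`σ ∕ hσ ∕ e ∕ he` — PART 1 of item6-p3 g13's `Item6OmegaTransportAtLine.v1.lean` (md5 d300c6f73c1e, 588 l.; author
prover-pub-hodgecm2-item6-p3-g13-0), SPLIT for the 400-line house rule by the Δ2-bridge PEN prover-pub-hodgecm2-d2bridge-prove-4-g1-0 with every
declaration BYTE-IDENTICAL to the author's (§1 characters of the line's unitary group moved to `U(1)(𝔸_f)` along the centre, §2 [Liu2021,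
Def. 4.12]'s admissible element at an ANTI-ORIENTED normaliser, §5 the instantiation kit for the line of record `⟨a⟩` and the normaliser
witnesses for `δ̄_F` and `(2δ_F)⁻¹`); PART 2 (`Transposition/Item6OmegaTransportAtLine.lean`) carries §3–§4 (`admIndexAtLine`,
`omegaTransportAtLine`).  This part reads no Liu datum: it imports the landed `Transposition/Item6RestOfChar` (for the CM-field kit) and
`Liu2021/Def411WeilCarriersAtLine` (`Rep`).  Definitions (`centerToLine`, `chiAtLine`, `realUnit`) + theorems; no named fact, no instance;
nothing landed is edited or restated.  Which normaliser is [Liu2021] AS PRINTED is decided by the CONSUMER (referee object-match (c):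
`(2δ_F)⁻¹`, `CorCM/D2Bridge/OmegaAtDeltaPrime.lean`), not here.  HC_CM is NOT proved; «Δ2 BRIDGE CLOSED» is NOT claimed; no pointer moves.
-/
import Summits.HodgeConjecture.CorCM.B01.Transposition.Item6RestOfChar
import Literature.NumberTheory.Automorphic.Liu2021.Def411WeilCarriersAtLine
import HarnessLib

set_option autoImplicit false

/-!
# X3-ω kit (part 1): `centerToLine ∕ chiAtLine`, admissibility at an anti-oriented normaliser, the line-of-record kit

* §1 `OmegaTransport.centerToLine`, `chiAtLine` (+ `isAutomorphicOneChar_comp_centerToLine`, `lineChar_chiAtLine`, `lineChar_chiAtLine_self`,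
  `chiAtLine_injective`);
* §2 `OmegaTransport.isAdmissibleElement_mul_of_antiOriented`;
* §5 `OmegaTransport.realUnit`, `JW_realUnit`, `TW_realUnit`, `JW_update_locF`, `TW_update_locF`, `algebraMap_update_locF`,
  `re_embedding_imagUnit`, `im_embedding_imagUnit_ne_zero`, the `−δ_F` triple (`antiOriented_neg_imagUnit`, `complexConj_neg_imagUnit`,
  `neg_imagUnit_ne_zero`) and the `(2δ_F)⁻¹` triple (`antiOriented_inv_two_mul_imagUnit`, `complexConj_inv_two_mul_imagUnit`,
  `inv_two_mul_imagUnit_ne_zero`).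

HC_CM is NOT proved.
-/

noncomputable section

open scoped TensorProduct Matrix

namespace Summit.HodgeConjecture.CorCM.Transposition.OmegaTransport

open NumberField IsDedekindDomain
open Literature.AlgebraicGeometry.Motives (CMType)
open Literature.AlgebraicGeometry.Liu2021 (IsAdmissibleElement)
open Literature.NumberTheory.Automorphic
open Literature.NumberTheory.Automorphic.Liu2021
open Literature.NumberTheory.Automorphic.Liu2021.Def411WeilCarriers (JW TW isSymm_TW isUnit_det_TW JW_eq JW_apply_ne_zero locF Eps Chi
  IsAutomorphicOneChar lineCenterEquiv lineCenterEquiv_apply lineChar)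
open Literature.NumberTheory.GelbartRogawski1991 Literature.NumberTheory.GelbartRogawski1991.UnitaryDualPair

/-! ## §1 Characters of the line's unitary group, moved to `U(1)(𝔸_f)` -/

section Center

variable (F : CMField)

/-- a group homomorphism out of a topological group whose kernel is open is continuous (the kernel is an open neighbourhood of `1` on
which the map is constant). [folklore] -/
private theorem continuous_of_isOpen_ker {G H : Type*} [Group G] [TopologicalSpace G] [IsTopologicalGroup G] [Group H]
    [TopologicalSpace H] [ContinuousMul H] (f : G →* H) (hf : IsOpen (f.ker : Set G)) : Continuous f := by
  apply continuous_of_continuousAt_one f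
  rw [ContinuousAt, map_one]
  intro U hU
  rw [Filter.mem_map]
  apply Filter.mem_of_superset (hf.mem_nhds (by simp))
  intro g hg
  rw [SetLike.mem_coe, MonoidHom.mem_ker] at hg
  rw [Set.mem_preimage, hg]
  exact mem_of_mem_nhds hU

/-- **`U(1)(𝔸_{F⁺,f}) ≃* U(J_W′)(𝔸_{F⁺,f})` for a line whose Gram matrix `J_W′` EQUALS `(a)`**: the tree's centre isomorphism `u ↦ u·1_W` onto
`U((a))` (`Def411WeilCarriers.lineCenterEquiv`) followed by the identity of the two (equal) subgroups of `GL₁(𝔸_{F,f})` (`MulEquiv.subgroupCongr`;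
underlying matrices unchanged). [cite: Mok2014, §1 Notation p. 5] -/
def centerToLine (a : (↥(maximalRealSubfield F))ˣ) (JW' : Matrix (Fin 1) (Fin 1) F) (hJ : JW ↥(maximalRealSubfield F) F a = JW') :
    UnitaryGroup.finAdelicOne ↥(maximalRealSubfield F) F (IsCMField.complexConj F) ≃*
      ↥(UnitaryGroup.finAdelic ↥(maximalRealSubfield F) F (IsCMField.complexConj F) 1 JW') :=
  (lineCenterEquiv ↥(maximalRealSubfield F) F (IsCMField.complexConj F) a).trans
    (MulEquiv.subgroupCongr (congrArg (UnitaryGroup.finAdelic ↥(maximalRealSubfield F) F (IsCMField.complexConj F) 1) hJ))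

/-- underlying matrix of `centerToLine a JW′ hJ u`: the scalar matrix `u · 1`. [cite: Mok2014, §1 Notation p. 5] -/
theorem coe_centerToLine (a : (↥(maximalRealSubfield F))ˣ) (JW' : Matrix (Fin 1) (Fin 1) F)
    (hJ : JW ↥(maximalRealSubfield F) F a = JW') (u : UnitaryGroup.finAdelicOne ↥(maximalRealSubfield F) F (IsCMField.complexConj F)) :
    (((centerToLine F a JW' hJ u : UnitaryGroup.finAdelic ↥(maximalRealSubfield F) F (IsCMField.complexConj F) 1 JW') :
        GL (Fin 1) (FiniteAdeleRing (𝓞 F) F)) : Matrix (Fin 1) (Fin 1) (FiniteAdeleRing (𝓞 F) F)) =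
      ((u : (FiniteAdeleRing (𝓞 F) F)ˣ) : FiniteAdeleRing (𝓞 F) F) • (1 : Matrix (Fin 1) (Fin 1) (FiniteAdeleRing (𝓞 F) F)) :=
  UnitaryGroup.coe_finAdelicCenter ↥(maximalRealSubfield F) F (IsCMField.complexConj F) 1 _ u

/-- the identity of two equal subgroups is continuous. [folklore] -/
private theorem continuous_subgroupCongr {G : Type*} [Group G] [TopologicalSpace G] {H K : Subgroup G} (hHK : H = K) :
    Continuous (MulEquiv.subgroupCongr hHK) := by
  subst hHK
  exact Continuous.subtype_mk continuous_subtype_val _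

/-- `centerToLine` is continuous (the centre map `u ↦ u·1` is, `UnitaryGroup.continuous_finAdelicCenter`). [cite: Mok2014, §1 Notation p. 5] -/
theorem continuous_centerToLine (a : (↥(maximalRealSubfield F))ˣ) (JW' : Matrix (Fin 1) (Fin 1) F)
    (hJ : JW ↥(maximalRealSubfield F) F a = JW') : Continuous (centerToLine F a JW' hJ) := by
  have hc : Continuous (lineCenterEquiv ↥(maximalRealSubfield F) F (IsCMField.complexConj F) a) :=
    (UnitaryGroup.continuous_finAdelicCenter (F := ↥(maximalRealSubfield F)) F (IsCMField.complexConj F) 1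
      (JW ↥(maximalRealSubfield F) F a)).congr fun u => rfl
  exact (continuous_subgroupCongr
    (congrArg (UnitaryGroup.finAdelic ↥(maximalRealSubfield F) F (IsCMField.complexConj F) 1) hJ)).comp hc

/-- **a character of the line's unitary group `U(J_W′)(𝔸_f)` with OPEN KERNEL and TRIVIAL RATIONAL RESTRICTION, pulled back to `U(1)(𝔸_f)`
along the centre, is an automorphic character of `E¹\(𝔸_E^∞)¹`** ([Liu2021] Def. 4.11, third bullet): continuity from the open kernel; a rational
norm-one `x` goes to the rational scalar matrix `x·1 ∈ U(J_W′)(F⁺)`. (The two hypotheses are the package's `SplitLine.IsAutChar χ`, unfolded by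
`isAutChar_iff`.) [cite: Liu2021, Def. 4.11 (FJcycle.tex l. 2090)] -/
theorem isAutomorphicOneChar_comp_centerToLine (a : (↥(maximalRealSubfield F))ˣ) (JW' : Matrix (Fin 1) (Fin 1) F)
    (hJ : JW ↥(maximalRealSubfield F) F a = JW')
    (χ : ↥(UnitaryGroup.finAdelic ↥(maximalRealSubfield F) F (IsCMField.complexConj F) 1 JW') →* ℂˣ)
    (hχo : IsOpen ((χ.ker : Subgroup _) : Set ↥(UnitaryGroup.finAdelic ↥(maximalRealSubfield F) F (IsCMField.complexConj F) 1 JW')))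
    (hχr : ∀ γ : UnitaryGroup.rational ↥(maximalRealSubfield F) F (IsCMField.complexConj F) 1 JW',
      χ (UnitaryGroup.rationalToFinAdelic ↥(maximalRealSubfield F) F (IsCMField.complexConj F) 1 JW' γ) = 1) :
    IsAutomorphicOneChar ↥(maximalRealSubfield F) F (IsCMField.complexConj F) (χ.comp (centerToLine F a JW' hJ).toMonoidHom) := by
  refine ⟨(continuous_of_isOpen_ker χ hχo).comp (continuous_centerToLine F a JW' hJ), fun x hx => ?_⟩
  -- the rational norm-one element `x` is the rational point `x·1 ∈ U(J_W′)(F⁺)`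
  have hx' : ((IsCMField.complexConj F : F ≃ₐ[↥(maximalRealSubfield F)] F) : F →+* F) (x : F) * x = 1 := by
    have h1 : UnitaryGroup.conjFiniteAdele ↥(maximalRealSubfield F) F (IsCMField.complexConj F)
        (algebraMap F (FiniteAdeleRing (𝓞 F) F) x) * algebraMap F (FiniteAdeleRing (𝓞 F) F) x = 1 := hx
    rw [← UnitaryGroup.algebraMap_galConj_finiteAdele, ← map_mul] at h1
    -- read the identity of finite adèles at one finite place `v` (`F → F_v` is injective)
    haveI : Nonempty (HeightOneSpectrum (𝓞 F)) := by
      obtain ⟨M, hM⟩ := Ideal.exists_maximal (𝓞 F)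
      exact ⟨⟨M, hM.isPrime, Ring.ne_bot_of_isMaximal_of_not_isField hM (RingOfIntegers.not_isField F)⟩⟩
    obtain ⟨v⟩ := (inferInstance : Nonempty (HeightOneSpectrum (𝓞 F)))
    have h2 := congrArg (fun z : FiniteAdeleRing (𝓞 F) F => z v) h1
    rw [FiniteAdeleRing.algebraMap_apply, adicCompletion_coe_eq_algebraMap] at h2
    have h3 : (1 : FiniteAdeleRing (𝓞 F) F) v = algebraMap F (v.adicCompletion F) 1 := by
      rw [map_one]
      rfl
    exact (algebraMap F (v.adicCompletion F)).injective (h2.trans h3)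
  let γ : UnitaryGroup.rational ↥(maximalRealSubfield F) F (IsCMField.complexConj F) 1 JW' :=
    ⟨Units.map (Matrix.scalar (Fin 1) : F →+* Matrix (Fin 1) (Fin 1) F).toMonoidHom x,
      scalar_mem_unitaryGroupOfForm _ JW' x hx'⟩
  have hγ : (centerToLine F a JW' hJ ⟨_, hx⟩) =
      UnitaryGroup.rationalToFinAdelic ↥(maximalRealSubfield F) F (IsCMField.complexConj F) 1 JW' γ := by
    apply Subtype.ext
    apply Units.ext
    rw [coe_centerToLine, UnitaryGroup.coe_rationalToFinAdelic, Matrix.smul_one_eq_diagonal]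
    show _ = (Matrix.scalar (Fin 1) (x : F)).map (algebraMap F (FiniteAdeleRing (𝓞 F) F))
    rw [Matrix.scalar_apply, Matrix.diagonal_map (map_zero _)]
    rfl
  show χ (centerToLine F a JW' hJ ⟨_, hx⟩) = 1
  rw [hγ]
  exact hχr γ

/-- **`χ ∘ centre ∈ Chi`**: the automorphic character of `E¹\(𝔸_E^∞)¹` attached to a character `χ` of `U(J_W′)(𝔸_f)` with open kernel and trivial
rational restriction — the `Chi`-component of the index `σ χ`. [cite: Liu2021, Def. 4.11 (FJcycle.tex l. 2090)] -/
def chiAtLine (a : (↥(maximalRealSubfield F))ˣ) (JW' : Matrix (Fin 1) (Fin 1) F) (hJ : JW ↥(maximalRealSubfield F) F a = JW')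
    (χ : ↥(UnitaryGroup.finAdelic ↥(maximalRealSubfield F) F (IsCMField.complexConj F) 1 JW') →* ℂˣ)
    (hχo : IsOpen ((χ.ker : Subgroup _) : Set ↥(UnitaryGroup.finAdelic ↥(maximalRealSubfield F) F (IsCMField.complexConj F) 1 JW')))
    (hχr : ∀ γ : UnitaryGroup.rational ↥(maximalRealSubfield F) F (IsCMField.complexConj F) 1 JW',
      χ (UnitaryGroup.rationalToFinAdelic ↥(maximalRealSubfield F) F (IsCMField.complexConj F) 1 JW' γ) = 1) :
    Chi ↥(maximalRealSubfield F) F (IsCMField.complexConj F) :=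
  ⟨χ.comp (centerToLine F a JW' hJ).toMonoidHom, isAutomorphicOneChar_comp_centerToLine F a JW' hJ χ hχo hχr⟩

/-- **the line character of `χ ∘ centre` is `χ`** (read back on `U((a))(𝔸_f)` along the identity of the equal subgroups):
`lineChar a (χ ∘ centre) = χ ∘ subgroupCongr`. [cite: Liu2021, App. D §D.1 Step 3 (FJcycle.tex l. 5221)] -/
theorem lineChar_chiAtLine (a : (↥(maximalRealSubfield F))ˣ) (JW' : Matrix (Fin 1) (Fin 1) F) (hJ : JW ↥(maximalRealSubfield F) F a = JW')
    (χ : ↥(UnitaryGroup.finAdelic ↥(maximalRealSubfield F) F (IsCMField.complexConj F) 1 JW') →* ℂˣ)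
    (hχo : IsOpen ((χ.ker : Subgroup _) : Set ↥(UnitaryGroup.finAdelic ↥(maximalRealSubfield F) F (IsCMField.complexConj F) 1 JW')))
    (hχr : ∀ γ : UnitaryGroup.rational ↥(maximalRealSubfield F) F (IsCMField.complexConj F) 1 JW',
      χ (UnitaryGroup.rationalToFinAdelic ↥(maximalRealSubfield F) F (IsCMField.complexConj F) 1 JW' γ) = 1) :
    lineChar ↥(maximalRealSubfield F) F (IsCMField.complexConj F) a (chiAtLine F a JW' hJ χ hχo hχr).1 =
      χ.comp (MulEquiv.subgroupCongr
        (congrArg (UnitaryGroup.finAdelic ↥(maximalRealSubfield F) F (IsCMField.complexConj F) 1) hJ)).toMonoidHom := by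
  refine MonoidHom.ext fun x => ?_
  show χ (MulEquiv.subgroupCongr (congrArg (UnitaryGroup.finAdelic ↥(maximalRealSubfield F) F (IsCMField.complexConj F) 1) hJ)
    (lineCenterEquiv ↥(maximalRealSubfield F) F (IsCMField.complexConj F) a
      ((lineCenterEquiv ↥(maximalRealSubfield F) F (IsCMField.complexConj F) a).symm x))) = _
  rw [MulEquiv.apply_symm_apply]
  rfl

/-- at `J_W′ = (a)` on the nose the line character of `χ ∘ centre` IS `χ`. [cite: Liu2021, App. D §D.1 Step 3 (FJcycle.tex l. 5221)] -/
theorem lineChar_chiAtLine_self (a : (↥(maximalRealSubfield F))ˣ)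
    (χ : ↥(UnitaryGroup.finAdelic ↥(maximalRealSubfield F) F (IsCMField.complexConj F) 1 (JW ↥(maximalRealSubfield F) F a)) →* ℂˣ)
    (hχo : IsOpen ((χ.ker : Subgroup _) : Set ↥(UnitaryGroup.finAdelic ↥(maximalRealSubfield F) F (IsCMField.complexConj F) 1
      (JW ↥(maximalRealSubfield F) F a))))
    (hχr : ∀ γ : UnitaryGroup.rational ↥(maximalRealSubfield F) F (IsCMField.complexConj F) 1 (JW ↥(maximalRealSubfield F) F a),
      χ (UnitaryGroup.rationalToFinAdelic ↥(maximalRealSubfield F) F (IsCMField.complexConj F) 1 (JW ↥(maximalRealSubfield F) F a) γ) = 1) :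
    lineChar ↥(maximalRealSubfield F) F (IsCMField.complexConj F) a (chiAtLine F a _ rfl χ hχo hχr).1 = χ := by
  rw [lineChar_chiAtLine]
  exact MonoidHom.ext fun x => rfl

/-- **`χ ↦ χ ∘ centre` is injective** (the centre isomorphism is onto). [cite: Liu2021, Def. 4.11 (FJcycle.tex l. 2090)] -/
theorem chiAtLine_injective (a : (↥(maximalRealSubfield F))ˣ) (JW' : Matrix (Fin 1) (Fin 1) F) (hJ : JW ↥(maximalRealSubfield F) F a = JW')
    {χ₁ χ₂ : ↥(UnitaryGroup.finAdelic ↥(maximalRealSubfield F) F (IsCMField.complexConj F) 1 JW') →* ℂˣ}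
    (h₁o : IsOpen ((χ₁.ker : Subgroup _) : Set ↥(UnitaryGroup.finAdelic ↥(maximalRealSubfield F) F (IsCMField.complexConj F) 1 JW')))
    (h₁r : ∀ γ : UnitaryGroup.rational ↥(maximalRealSubfield F) F (IsCMField.complexConj F) 1 JW',
      χ₁ (UnitaryGroup.rationalToFinAdelic ↥(maximalRealSubfield F) F (IsCMField.complexConj F) 1 JW' γ) = 1)
    (h₂o : IsOpen ((χ₂.ker : Subgroup _) : Set ↥(UnitaryGroup.finAdelic ↥(maximalRealSubfield F) F (IsCMField.complexConj F) 1 JW')))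
    (h₂r : ∀ γ : UnitaryGroup.rational ↥(maximalRealSubfield F) F (IsCMField.complexConj F) 1 JW',
      χ₂ (UnitaryGroup.rationalToFinAdelic ↥(maximalRealSubfield F) F (IsCMField.complexConj F) 1 JW' γ) = 1)
    (h : chiAtLine F a JW' hJ χ₁ h₁o h₁r = chiAtLine F a JW' hJ χ₂ h₂o h₂r) : χ₁ = χ₂ := by
  have h' : χ₁.comp (centerToLine F a JW' hJ).toMonoidHom = χ₂.comp (centerToLine F a JW' hJ).toMonoidHom :=
    congrArg Subtype.val h
  exact (MonoidHom.cancel_right (MulEquiv.surjective (centerToLine F a JW' hJ))).1 h'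

end Center

/-! ## §2 Admissibility at an anti-oriented normaliser -/

section Adm

variable (F : CMField)

/-- **[Liu2021, Def. 4.12]'s admissible element at an ANTI-ORIENTED normaliser**: if `Φ` is δ-POSITIVE at the real scalar `a`
(`0 < Im τ(δ_F · a)` for `τ ∈ Φ` — the package's `Φ^δ(a)`, `SignRecipe.mem_lineType_iff`) and `δ′ ∈ F^{×−}` is anti-oriented to `δ_F`
(`Im τ(δ′) · Im τ(δ_F) < 0` at every `τ`), then `e₀ := a · δ′` is admissible for `Φ`: `e₀ ≠ 0`, `ē₀ = −e₀`, and `Im τ(e₀) = τ(a) · Im τ(δ′) < 0`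
on `Φ` (`τ(a)` is real, of the sign of `Im τ(δ_F)` there). [cite: Liu2021, Def. 4.12 (FJcycle.tex l. 2102–2108)] -/
theorem isAdmissibleElement_mul_of_antiOriented (Φ : CMType F) (a : (↥(maximalRealSubfield F))ˣ) (δ' : F)
    (hcδ' : IsCMField.complexConj F δ' = -δ') (hδ'0 : δ' ≠ 0)
    (hδ' : ∀ τ : F →+* ℂ, (τ δ').im * (τ (imagUnit F)).im < 0)
    (hΦ : ∀ τ : F →+* ℂ, τ ∈ Φ.1 → 0 < (τ (imagUnit F * algebraMap ↥(maximalRealSubfield F) F a)).im) :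
    IsAdmissibleElement F Φ.1 (algebraMap ↥(maximalRealSubfield F) F a * δ') := by
  refine ⟨mul_ne_zero ((map_ne_zero _).2 a.ne_zero) hδ'0, ?_, fun τ hτ => ?_⟩
  · rw [map_mul, AlgEquiv.commutes, hcδ', mul_neg]
  · -- `τ(a)` is real
    have hre : (τ (algebraMap ↥(maximalRealSubfield F) F a)).im = 0 := by
      have hmem := (a : ↥(maximalRealSubfield F)).2
      rw [NumberField.mem_maximalRealSubfield_iff] at hmem
      exact Complex.conj_eq_iff_im.1 (hmem τ)
    have h1 := hΦ τ hτ
    have h2 := hδ' τ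
    simp only [map_mul, Complex.mul_im, hre, mul_zero, zero_mul, zero_add, add_zero] at h1 ⊢
    nlinarith [sq_nonneg ((τ (imagUnit F)).im), sq_nonneg ((τ (algebraMap ↥(maximalRealSubfield F) F a)).re), h1, h2,
      mul_pos_iff.1 h1]

end Adm

end Summit.HodgeConjecture.CorCM.Transposition.OmegaTransport

/-! ## §5 Instantiation kit for the line of record `⟨a⟩` (`a ∈ L` real, non-zero) and the two anti-oriented normalisers -/

namespace Summit.HodgeConjecture.CorCM.Transposition.OmegaTransport

open NumberField
open Literature.NumberTheory.Automorphic.Liu2021.Def411WeilCarriers (JW TW locF Rep)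
open Literature.NumberTheory.GelbartRogawski1991.UnitaryDualPair

variable (F : CMField)

/-- **the unit `u_a ∈ (F⁺)ˣ` of a non-zero conjugation-fixed scalar `a ∈ F`** (the Gram scalar of the line of record). [folklore] -/
def realUnit (a : F) (ha : IsCMField.complexConj F a = a) (ha0 : a ≠ 0) : (↥(maximalRealSubfield F))ˣ :=
  Units.mk0 ⟨a, (IsCMField.complexConj_eq_self_iff (K := F) a).1 ha⟩ fun h => ha0 (congrArg Subtype.val h)

/-- `u_a` read in `F` is `a`. [folklore] -/
@[simp] theorem algebraMap_realUnit (a : F) (ha : IsCMField.complexConj F a = a) (ha0 : a ≠ 0) :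
    algebraMap ↥(maximalRealSubfield F) F (realUnit F a ha ha0) = a := rfl

/-- **`J_W(u_a) = diag(a)`** — the line `⟨u_a⟩` of `Def411WeilCarriers` IS the line of record's Gram matrix `Matrix.diagonal (fun _ ↦ a)`
(the package's `diagonal (vec a)`). [folklore] -/
theorem JW_realUnit (a : F) (ha : IsCMField.complexConj F a = a) (ha0 : a ≠ 0) :
    JW ↥(maximalRealSubfield F) F (realUnit F a ha ha0) = Matrix.diagonal fun _ : Fin 1 => a := by
  ext i j
  fin_cases i; fin_cases j
  simp [JW, TW, realUnit]
  rfl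

/-- **`T_W(u_a) = realDiagonal (fun _ ↦ a)`** (the package's `realDiagonal L (vec a) _`). [folklore] -/
theorem TW_realUnit (a : F) (ha : IsCMField.complexConj F a = a) (ha0 : a ≠ 0) :
    TW ↥(maximalRealSubfield F) (realUnit F a ha ha0) = realDiagonal F (fun _ : Fin 1 => a) fun _ => ha := by
  ext i j
  fin_cases i; fin_cases j
  simp [TW, realUnit, realDiagonal]

/-- the re-pointed representative section takes the value `u` at `locF u` (`Rep.update_toFun_self`), read on `J_W`. [folklore] -/
theorem JW_update_locF (r : Rep ↥(maximalRealSubfield F) (imagUnitSq F)) (u : (↥(maximalRealSubfield F))ˣ) :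
    JW ↥(maximalRealSubfield F) F
        ((Rep.update ↥(maximalRealSubfield F) (imagUnitSq F) r (locF ↥(maximalRealSubfield F) (imagUnitSq F) u) u rfl).toFun
          (locF ↥(maximalRealSubfield F) (imagUnitSq F) u)) =
      JW ↥(maximalRealSubfield F) F u := by
  rw [Rep.update_toFun_self]

/-- … and on `T_W`. [folklore] -/
theorem TW_update_locF (r : Rep ↥(maximalRealSubfield F) (imagUnitSq F)) (u : (↥(maximalRealSubfield F))ˣ) :
    TW ↥(maximalRealSubfield F)
        ((Rep.update ↥(maximalRealSubfield F) (imagUnitSq F) r (locF ↥(maximalRealSubfield F) (imagUnitSq F) u) u rfl).toFun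
          (locF ↥(maximalRealSubfield F) (imagUnitSq F) u)) =
      TW ↥(maximalRealSubfield F) u := by
  rw [Rep.update_toFun_self]

/-- … and in `F`. [folklore] -/
theorem algebraMap_update_locF (r : Rep ↥(maximalRealSubfield F) (imagUnitSq F)) (u : (↥(maximalRealSubfield F))ˣ) :
    algebraMap ↥(maximalRealSubfield F) F
        ((Rep.update ↥(maximalRealSubfield F) (imagUnitSq F) r (locF ↥(maximalRealSubfield F) (imagUnitSq F) u) u rfl).toFun
          (locF ↥(maximalRealSubfield F) (imagUnitSq F) u)) =
      algebraMap ↥(maximalRealSubfield F) F u := by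
  rw [Rep.update_toFun_self]

/-- `Re τ(δ_F) = 0`: `τ(δ̄_F) = conj τ(δ_F)` and `δ̄_F = −δ_F`. [folklore] -/
theorem re_embedding_imagUnit (τ : F →+* ℂ) : (τ (imagUnit F)).re = 0 := by
  have h : τ (IsCMField.complexConj F (imagUnit F)) = starRingEnd ℂ (τ (imagUnit F)) :=
    IsCMField.complexEmbedding_complexConj (K := F) τ (imagUnit F)
  rw [complexConj_imagUnit, map_neg] at h
  have h' := congrArg Complex.re h
  rw [Complex.neg_re, Complex.conj_re] at h'
  linarith

/-- `Im τ(δ_F) ≠ 0` (`δ_F ≠ 0` is purely imaginary under every complex embedding). [folklore] -/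
theorem im_embedding_imagUnit_ne_zero (τ : F →+* ℂ) : (τ (imagUnit F)).im ≠ 0 := by
  intro h0
  have hz : τ (imagUnit F) = 0 :=
    Complex.ext (by rw [re_embedding_imagUnit, Complex.zero_re]) (by rw [h0, Complex.zero_im])
  exact imagUnit_ne_zero F ((map_eq_zero τ).1 hz)

/-- **the normaliser `δ̄_F = −δ_F` is anti-oriented to `δ_F`.** [folklore] -/
theorem antiOriented_neg_imagUnit (τ : F →+* ℂ) : (τ (-imagUnit F)).im * (τ (imagUnit F)).im < 0 := by
  rw [map_neg, Complex.neg_im, neg_mul]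
  exact neg_lt_zero.2 (mul_self_pos.2 (im_embedding_imagUnit_ne_zero F τ))

/-- `δ̄_F` is purely imaginary. [folklore] -/
theorem complexConj_neg_imagUnit : IsCMField.complexConj F (-imagUnit F) = -(-imagUnit F) := by
  rw [map_neg, complexConj_imagUnit]

/-- `δ̄_F ≠ 0`. [folklore] -/
theorem neg_imagUnit_ne_zero : -imagUnit F ≠ 0 := neg_ne_zero.2 (imagUnit_ne_zero F)

/-- **the normaliser `(2δ_F)⁻¹` is anti-oriented to `δ_F`** (`Im (2τδ)⁻¹ = −2·Im τδ / |2τδ|²`). [folklore] -/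
theorem antiOriented_inv_two_mul_imagUnit (τ : F →+* ℂ) : (τ (2 * imagUnit F)⁻¹).im * (τ (imagUnit F)).im < 0 := by
  have hne := im_embedding_imagUnit_ne_zero F τ
  have hw : (τ (2 * imagUnit F)).im = 2 * (τ (imagUnit F)).im := by
    rw [map_mul, map_ofNat, Complex.mul_im, Complex.re_ofNat, Complex.im_ofNat, zero_mul, add_zero]
  have hns : 0 < Complex.normSq (τ (2 * imagUnit F)) :=
    Complex.normSq_pos.2 ((map_ne_zero τ).2 (mul_ne_zero two_ne_zero (imagUnit_ne_zero F)))
  rw [map_inv₀, Complex.inv_im, hw, div_mul_eq_mul_div, neg_mul, neg_div, neg_lt_zero, mul_assoc]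
  exact div_pos (mul_pos two_pos (mul_self_pos.2 hne)) hns

/-- `(2δ_F)⁻¹` is purely imaginary. [folklore] -/
theorem complexConj_inv_two_mul_imagUnit : IsCMField.complexConj F (2 * imagUnit F)⁻¹ = -(2 * imagUnit F)⁻¹ := by
  rw [map_inv₀, map_mul, map_ofNat, complexConj_imagUnit, mul_neg, inv_neg]

/-- `(2δ_F)⁻¹ ≠ 0`. [folklore] -/
theorem inv_two_mul_imagUnit_ne_zero : (2 * imagUnit F)⁻¹ ≠ 0 :=
  inv_ne_zero (mul_ne_zero two_ne_zero (imagUnit_ne_zero F))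

end Summit.HodgeConjecture.CorCM.Transposition.OmegaTransport

end
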